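import Literature.Computability.Complexity.HardcoreInapproximabilityCyclesJoint
import Literature.Computability.Complexity.HardcoreInapproximabilityCycleCounts
import Literature.Computability.Complexity.HardcoreInapproximabilitySSCAbstract
import HarnessLib

/-!
# Sly (2010), Lemma 3.7 in `ε`-form — binomial moments of the short cycle counts

For the configuration-type core `G̃(n+m', q)` (realisations `ω = (σ, τ)`), the cycle counts
`X_i = slyCycleX n m' q k i` (number of `2(i+1)`-cycles, `i < k`) have joint binomial moments
`E[Π_i C(X_i, c_i)]` within a factor `1 ± ε` of the independent-Poisson values `Π_i λ_i^{c_i}/c_i!`,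
`λ_i = (q^{2(i+1)}+q)/(2(i+1))` (`slyCycleLam`), uniformly over all orders `c ≤ 2B`, for `n ≥ n₀(q,k,B,ε)`
and `m' ≤ n^{1/10}` (`sly_cycleBinom_bounds`).  This is hypothesis (U)/(L) of the abstract
small-subgraph-conditioning bound `ssc_lowerTail_le'`; it is the counting form of the two-sided
factorial-moment bounds `avg_prod_slyDistinctTuples_le/ge` (`HardcoreInapproximabilityCyclesJoint`)
via `DT_m = (2j)^m m! C(X_{2j}, m)` (`HardcoreInapproximabilityCycleCounts`).

## References
* [Sly2010] A. Sly, *Computational transition at the uniqueness threshold*, FOCS 2010,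
  arXiv:1005.5584, Lemma 3.7.
* [MosselWeitzWormald2008] E. Mossel, D. Weitz, N. Wormald, *On the hardness of sampling
  independent sets beyond the tree threshold*, PTRF 143 (2009), Lemma 7.3.
-/

namespace Literature.Computability.Complexity

open Finset Real Filter Topology

section CycleMoments

variable {n m' q k : ℕ}

/-- The cycle counts of the core as a `Fin k`-indexed family: `X_i = #(2(i+1))-cycles`. [cite: Sly2010, Lemma 3.7] -/
noncomputable def slyCycleX (n m' q k : ℕ) (i : Fin k) (ω : (Fin q → Equiv.Perm (Fin (n + m'))) × Equiv.Perm (Fin n)) : ℕ :=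
  slyNumCycles n m' q ((i : ℕ) + 1) ω.1 ω.2

/-- The Poisson means `λ_i = (q^{2(i+1)} + q)/(2(i+1))`. [cite: Sly2010, Lemma 3.7] -/
noncomputable def slyCycleLam (q k : ℕ) (i : Fin k) : ℝ := ((q : ℝ) ^ (2 * ((i : ℕ) + 1)) + q) / (2 * ((i : ℝ) + 1))

/-- `λ_i ≥ 0`. [folklore] -/
theorem slyCycleLam_nonneg (q k : ℕ) (i : Fin k) : 0 ≤ slyCycleLam q k i := by
  unfold slyCycleLam; positivity

/-- **Distinct tuples versus binomial products**:
`Π_i DT_i(c_i) = Π_i ((2(i+1))^{c_i} c_i!) · Π_i C(X_i, c_i)`. [folklore] -/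
theorem prod_slyDistinctTuples_eq_mul_sscBinom (c : Fin k → ℕ) (ω : (Fin q → Equiv.Perm (Fin (n + m'))) × Equiv.Perm (Fin n)) :
    ((∏ i : Fin k, slyDistinctTuples n m' q ((i : ℕ) + 1) (c i) ω.1 ω.2 : ℕ) : ℝ) =
      (∏ i : Fin k, ((2 * ((i : ℕ) + 1)) ^ c i * (c i).factorial : ℝ)) * sscBinom (slyCycleX n m' q k) c ω := by
  unfold sscBinom slyCycleX
  push_cast
  rw [← Finset.prod_mul_distrib]
  refine Finset.prod_congr rfl fun i _ => ?_
  rw [slyDistinctTuples_eq_choose (Nat.succ_pos _)]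
  push_cast
  ring

/-- `Π_i λ_i^{c_i}/c_i! · Π_i ((2(i+1))^{c_i} c_i!) = Π_i (q^{2(i+1)}+q)^{c_i}`. [folklore] -/
theorem prod_slyCycleLam_mul (q : ℕ) (c : Fin k → ℕ) :
    (∏ i : Fin k, slyCycleLam q k i ^ c i / ((c i).factorial : ℝ)) * (∏ i : Fin k, ((2 * ((i : ℕ) + 1)) ^ c i * (c i).factorial : ℝ)) =
      ∏ i : Fin k, ((q : ℝ) ^ (2 * ((i : ℕ) + 1)) + q) ^ (c i) := by
  rw [← Finset.prod_mul_distrib]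
  refine Finset.prod_congr rfl fun i _ => ?_
  unfold slyCycleLam
  have h1 : (0 : ℝ) < 2 * ((i : ℝ) + 1) := by positivity
  have h2 : (0 : ℝ) < (c i).factorial := by exact_mod_cast Nat.factorial_pos _
  rw [div_pow]
  field_simp

/-- `J ≤ k² B` when all multiplicities are `≤ B`. [folklore] -/
theorem slyFamJ_le {k B : ℕ} {mv : Fin k → ℕ} (h : ∀ i, mv i ≤ B) : slyFamJ mv ≤ k * k * B := by
  unfold slyFamJ
  calc ∑ i : Fin k, mv i * ((i : ℕ) + 1) ≤ ∑ _i : Fin k, B * k :=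
        Finset.sum_le_sum fun i _ => Nat.mul_le_mul (h i) i.is_lt
    _ = k * k * B := by rw [Finset.sum_const, Finset.card_univ, Fintype.card_fin, smul_eq_mul]; ring

/-- `(n/(n-2J))^{2J} ≤ 1/(1 - 4J²/n)` (`4J² < n`). [folklore] -/
theorem sly_pow_ratio_le (n J : ℕ) (hn : 4 * (J : ℝ) ^ 2 < n) (hJn : 2 * J < n) :
    ((n : ℝ) / ((n : ℝ) - 2 * J)) ^ (2 * J) ≤ 1 / (1 - 4 * (J : ℝ) ^ 2 / n) := by
  have hn0 : (0 : ℝ) < n := by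
    have : (0 : ℝ) ≤ 4 * (J : ℝ) ^ 2 := by positivity
    linarith
  have hx : (0 : ℝ) < (n : ℝ) - 2 * J := by
    have : ((2 * J : ℕ) : ℝ) < n := by exact_mod_cast hJn
    push_cast at this; linarith
  have hJ0 : (0 : ℝ) ≤ J := Nat.cast_nonneg J
  -- Bernoulli for the reciprocal
  have hb := one_add_mul_le_pow (a := -(2 * (J : ℝ) / n)) (by
    rw [neg_le, neg_neg, div_le_iff₀ hn0]
    have : ((2 * J : ℕ) : ℝ) < n := by exact_mod_cast hJn
    push_cast at this; linarith) (2 * J)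
  have heq : (1 + -(2 * (J : ℝ) / n)) = ((n : ℝ) - 2 * J) / n := by field_simp; ring
  rw [heq] at hb
  have hlow : 1 - 4 * (J : ℝ) ^ 2 / n ≤ (((n : ℝ) - 2 * J) / n) ^ (2 * J) := by
    refine le_trans (le_of_eq ?_) hb
    push_cast; field_simp; ring
  have hpos : 0 < 1 - 4 * (J : ℝ) ^ 2 / n := by
    rw [sub_pos, div_lt_one hn0]; exact hn
  rw [div_pow, ← one_div_div, one_div_le_one_div (by positivity) hpos]
  rw [div_pow] at hlow
  exact hlow

set_option maxHeartbeats 800000 in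
/-- **Binomial moments of the cycle counts, both bounds** (`ε`-form of Sly's Lemma 3.7, all orders
`≤ 2B` at once): for `n ≥ n₀` and `m' ≤ n^{1/10}`,
`(1-ε)|Ω| Π λ_i^{c_i}/c_i! ≤ Σ_ω Π_i C(X_i(ω), c_i) ≤ (1+ε)|Ω| Π λ_i^{c_i}/c_i!`. [cite: Sly2010, Lemma 3.7] -/
theorem sly_cycleBinom_bounds (q k B : ℕ) (hq : 1 ≤ q) {ε : ℝ} (hε : 0 < ε) :
    ∃ n₀ : ℕ, ∀ n : ℕ, n₀ ≤ n → ∀ m' : ℕ, (m' : ℝ) ≤ (n : ℝ) ^ (1 / 10 : ℝ) →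
      ∀ c : Fin k → ℕ, (∀ i, c i ≤ 2 * B) →
        (∑ ω : (Fin q → Equiv.Perm (Fin (n + m'))) × Equiv.Perm (Fin n), sscBinom (slyCycleX n m' q k) c ω ≤
            (1 + ε) * Fintype.card ((Fin q → Equiv.Perm (Fin (n + m'))) × Equiv.Perm (Fin n)) *
              ∏ i : Fin k, slyCycleLam q k i ^ c i / ((c i).factorial : ℝ)) ∧
        ((1 - ε) * Fintype.card ((Fin q → Equiv.Perm (Fin (n + m'))) × Equiv.Perm (Fin n)) *
              ∏ i : Fin k, slyCycleLam q k i ^ c i / ((c i).factorial : ℝ) ≤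
            ∑ ω : (Fin q → Equiv.Perm (Fin (n + m'))) × Equiv.Perm (Fin n), sscBinom (slyCycleX n m' q k) c ω) := by
  set Jm : ℕ := k * k * (2 * B) with hJm
  set K : ℝ := (((Jm + 1) ^ 2 : ℕ) : ℝ) * (((Jm * Jm * ((q + 1) * (q + 1))) ^ Jm : ℕ) : ℝ) with hK
  have hK0 : 0 ≤ K := by positivity
  -- eventual conditions
  have T0 : Tendsto (fun n : ℕ => ((n : ℝ))⁻¹) atTop (𝓝 0) := tendsto_inv_atTop_zero.comp tendsto_natCast_atTop_atTop
  have T9 : Tendsto (fun n : ℕ => (n : ℝ) ^ (-(9 / 10) : ℝ)) atTop (𝓝 0) :=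
    (tendsto_rpow_neg_atTop (by norm_num)).comp tendsto_natCast_atTop_atTop
  have E0 : ∀ᶠ n : ℕ in atTop, 1 ≤ n := eventually_ge_atTop 1
  have E1 : ∀ᶠ n : ℕ in atTop, (16 * (Jm : ℝ) ^ 2 + 4 * Jm + 2 : ℝ) ≤ n := tendsto_natCast_atTop_atTop.eventually_ge_atTop _
  have E2 : ∀ᶠ n : ℕ in atTop, (16 * (Jm : ℝ) ^ 2 + 4 * K + 2 * (Jm : ℝ) ^ 2) * ((n : ℝ))⁻¹ ≤ ε / 4 := by
    have := T0.const_mul (16 * (Jm : ℝ) ^ 2 + 4 * K + 2 * (Jm : ℝ) ^ 2)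
    rw [mul_zero] at this
    exact this.eventually_le_const (by positivity)
  have E3 : ∀ᶠ n : ℕ in atTop, 2 * (Jm : ℝ) * (n : ℝ) ^ (-(9 / 10) : ℝ) ≤ ε / 4 := by
    have := T9.const_mul (2 * (Jm : ℝ))
    rw [mul_zero] at this
    exact this.eventually_le_const (by positivity)
  obtain ⟨n₀, hn₀⟩ := Filter.eventually_atTop.1 (E0.and (E1.and (E2.and E3)))
  refine ⟨n₀, fun n hn m' hm' c hc => ?_⟩
  obtain ⟨e0, e1, e2, e3⟩ := hn₀ n hn
  have hn1 : (1 : ℝ) ≤ n := by exact_mod_cast e0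
  have hn0 : (0 : ℝ) < n := by linarith
  have hinv : (0 : ℝ) ≤ ((n : ℝ))⁻¹ := inv_nonneg.2 hn0.le
  -- `J ≤ Jm`
  have hJ := slyFamJ_le hc
  rw [← hJm] at hJ
  set J := slyFamJ c with hJdef
  have hJr : (J : ℝ) ≤ Jm := by exact_mod_cast hJ
  have hJ0 : (0 : ℝ) ≤ J := Nat.cast_nonneg J
  have hJm0 : (0 : ℝ) ≤ Jm := Nat.cast_nonneg Jm
  have hJsq : (J : ℝ) ^ 2 ≤ (Jm : ℝ) ^ 2 := pow_le_pow_left₀ hJ0 hJr 2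
  have hJm2 : (0 : ℝ) ≤ (Jm : ℝ) ^ 2 := sq_nonneg _
  -- split `e2`
  have e2a : 16 * (Jm : ℝ) ^ 2 * ((n : ℝ))⁻¹ ≤ ε / 4 := le_trans (mul_le_mul_of_nonneg_right (by linarith) hinv) e2
  have e2b : 4 * K * ((n : ℝ))⁻¹ ≤ ε / 4 := le_trans (mul_le_mul_of_nonneg_right (by linarith) hinv) e2
  have e2c : 2 * (Jm : ℝ) ^ 2 * ((n : ℝ))⁻¹ ≤ ε / 4 := le_trans (mul_le_mul_of_nonneg_right (by linarith) hinv) e2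
  have h2Jn : 2 * J < n := by
    have h' : ((2 * J + 1 : ℕ) : ℝ) ≤ n := by push_cast; linarith
    have h'' : 2 * J + 1 ≤ n := by exact_mod_cast h'
    omega
  -- constants
  set Ωc : ℝ := (((n + m').factorial : ℝ) ^ q) * (n.factorial : ℝ) with hΩc
  have hΩc0 : 0 < Ωc := by
    have h1 : (0 : ℝ) < (n + m').factorial := by exact_mod_cast Nat.factorial_pos _
    have h2 : (0 : ℝ) < n.factorial := by exact_mod_cast Nat.factorial_pos _
    positivity
  have hcard : (Fintype.card ((Fin q → Equiv.Perm (Fin (n + m'))) × Equiv.Perm (Fin n)) : ℝ) = Ωc := by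
    rw [hΩc, Fintype.card_prod, Fintype.card_pi, Fintype.card_perm, Fintype.card_perm, Fintype.card_fin, Fintype.card_fin]
    push_cast
    rw [Finset.prod_const, Finset.card_univ, Fintype.card_fin]
  set D : ℝ := ∏ i : Fin k, ((2 * ((i : ℕ) + 1)) ^ c i * (c i).factorial : ℝ) with hD
  have hD0 : 0 < D := by
    rw [hD]; refine Finset.prod_pos fun i _ => ?_
    have : (0 : ℝ) < (c i).factorial := by exact_mod_cast Nat.factorial_pos _
    positivity
  set P : ℝ := ∏ i : Fin k, ((q : ℝ) ^ (2 * ((i : ℕ) + 1)) + q) ^ (c i) with hP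
  have hP1 : 1 ≤ P := by
    rw [hP]
    have hq1 : (1 : ℝ) ≤ q := by exact_mod_cast hq
    calc (1 : ℝ) = ∏ _i : Fin k, (1 : ℝ) := by simp
      _ ≤ _ := Finset.prod_le_prod (fun _ _ => zero_le_one) fun i _ => by
          have : (1 : ℝ) ≤ (q : ℝ) ^ (2 * ((i : ℕ) + 1)) + q := by
            have := one_le_pow₀ (M₀ := ℝ) (n := 2 * ((i : ℕ) + 1)) hq1; linarith
          exact one_le_pow₀ this
  have hlamD : (∏ i : Fin k, slyCycleLam q k i ^ c i / ((c i).factorial : ℝ)) = P / D := by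
    rw [eq_div_iff hD0.ne', hP, hD]; exact prod_slyCycleLam_mul q c
  -- the sum of binomial products in terms of distinct tuples
  have hsum : ∑ ω : (Fin q → Equiv.Perm (Fin (n + m'))) × Equiv.Perm (Fin n), sscBinom (slyCycleX n m' q k) c ω =
      (∑ ω : (Fin q → Equiv.Perm (Fin (n + m'))) × Equiv.Perm (Fin n),
        ((∏ i : Fin k, slyDistinctTuples n m' q ((i : ℕ) + 1) (c i) ω.1 ω.2 : ℕ) : ℝ)) / D := by
    rw [eq_div_iff hD0.ne', Finset.sum_mul]
    refine Finset.sum_congr rfl fun ω _ => ?_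
    rw [prod_slyDistinctTuples_eq_mul_sscBinom, hD]; ring
  have hup := avg_prod_slyDistinctTuples_le (n := n) (m' := m') (q := q) c h2Jn
  have hlo := avg_prod_slyDistinctTuples_ge (n := n) (m' := m') (q := q) c h2Jn
  rw [← hJdef, ← hP] at hup hlo
  -- the ratio factors
  have h4J : 4 * (J : ℝ) ^ 2 < n := by linarith
  have hρ := sly_pow_ratio_le n J h4J h2Jn
  have hsmall : 4 * (J : ℝ) ^ 2 / n ≤ 1 / 2 := by
    rw [div_le_iff₀ hn0]; linarith
  have hpos' : 0 < 1 - 4 * (J : ℝ) ^ 2 / n := by linarith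
  have hρ' : ((n : ℝ) / ((n : ℝ) - 2 * J)) ^ (2 * J) ≤ 1 + 8 * (J : ℝ) ^ 2 / n := by
    refine le_trans hρ ?_
    set x : ℝ := 4 * (J : ℝ) ^ 2 / n with hxdef
    have hx8 : 8 * (J : ℝ) ^ 2 / n = 2 * x := by rw [hxdef]; ring
    have hxnn : 0 ≤ x := by positivity
    rw [hx8, div_le_iff₀ hpos']
    nlinarith [hsmall, hxnn]
  have hρ2 : ((n : ℝ) / ((n : ℝ) - 2 * J)) ^ (2 * J) ≤ 2 := by
    have : 8 * (J : ℝ) ^ 2 / n ≤ 1 := by rw [div_le_iff₀ hn0]; linarith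
    linarith
  have hx : (n : ℝ) / 2 ≤ (n : ℝ) - 2 * J := by linarith
  have hx0 : 0 < (n : ℝ) - 2 * J := by linarith
  constructor
  · -- upper bound
    rw [hsum, hcard, hlamD, div_le_iff₀ hD0]
    rw [div_le_iff₀ hΩc0] at hup
    have hKJ : (((J + 1) ^ 2 : ℕ) : ℝ) * (((J * J * ((q + 1) * (q + 1))) ^ J : ℕ) : ℝ) ≤ K := by
      rw [hK]
      have a1 : ((J + 1) ^ 2 : ℕ) ≤ (Jm + 1) ^ 2 := Nat.pow_le_pow_left (by omega) 2
      have a2 : (J * J * ((q + 1) * (q + 1))) ^ J ≤ (Jm * Jm * ((q + 1) * (q + 1))) ^ Jm := by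
        calc (J * J * ((q + 1) * (q + 1))) ^ J ≤ (Jm * Jm * ((q + 1) * (q + 1))) ^ J :=
              Nat.pow_le_pow_left (Nat.mul_le_mul (Nat.mul_le_mul hJ hJ) le_rfl) J
          _ ≤ (Jm * Jm * ((q + 1) * (q + 1))) ^ Jm := by
              rcases Nat.eq_zero_or_pos Jm with hz | hpos
              · have hJz : J = 0 := by omega
                rw [hJz, hz]
              · exact Nat.pow_le_pow_right (Nat.mul_pos (Nat.mul_pos hpos hpos) (by positivity)) hJ
      have b1 : (((J + 1) ^ 2 : ℕ) : ℝ) ≤ (((Jm + 1) ^ 2 : ℕ) : ℝ) := by exact_mod_cast a1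
      have b2 : (((J * J * ((q + 1) * (q + 1))) ^ J : ℕ) : ℝ) ≤ (((Jm * Jm * ((q + 1) * (q + 1))) ^ Jm : ℕ) : ℝ) := by exact_mod_cast a2
      exact mul_le_mul b1 b2 (Nat.cast_nonneg _) (Nat.cast_nonneg _)
    have hE : (((J + 1) ^ 2 : ℕ) : ℝ) * (((J * J * ((q + 1) * (q + 1))) ^ J : ℕ) : ℝ) *
        (((n : ℝ) / ((n : ℝ) - 2 * J)) ^ (2 * J) / ((n : ℝ) - 2 * J)) ≤ K * (2 / ((n : ℝ) / 2)) := by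
      refine mul_le_mul hKJ ?_ (by positivity) hK0
      rw [div_le_div_iff₀ hx0 (by positivity)]
      nlinarith [hρ2, hx]
    have hE' : K * (2 / ((n : ℝ) / 2)) = 4 * K * ((n : ℝ))⁻¹ := by field_simp; ring
    rw [hE'] at hE
    calc ∑ ω : (Fin q → Equiv.Perm (Fin (n + m'))) × Equiv.Perm (Fin n),
          ((∏ i : Fin k, slyDistinctTuples n m' q ((i : ℕ) + 1) (c i) ω.1 ω.2 : ℕ) : ℝ)
        ≤ (P * ((n : ℝ) / ((n : ℝ) - 2 * J)) ^ (2 * J) +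
            (((J + 1) ^ 2 : ℕ) : ℝ) * (((J * J * ((q + 1) * (q + 1))) ^ J : ℕ) : ℝ) *
              (((n : ℝ) / ((n : ℝ) - 2 * J)) ^ (2 * J) / ((n : ℝ) - 2 * J))) * Ωc := hup
      _ ≤ (P * (1 + 8 * (J : ℝ) ^ 2 / n) + 4 * K * ((n : ℝ))⁻¹) * Ωc := by
          refine mul_le_mul_of_nonneg_right (add_le_add (mul_le_mul_of_nonneg_left hρ' (by linarith)) hE) hΩc0.le
      _ ≤ (1 + ε) * Ωc * (P / D) * D := by
          rw [show (1 + ε) * Ωc * (P / D) * D = (1 + ε) * Ωc * P by field_simp]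
          have h8 : 8 * (J : ℝ) ^ 2 / n ≤ ε / 2 := by
            have : 8 * (J : ℝ) ^ 2 / n ≤ 16 * (Jm : ℝ) ^ 2 * ((n : ℝ))⁻¹ := by
              rw [div_eq_mul_inv]; exact mul_le_mul_of_nonneg_right (by nlinarith) hinv
            linarith
          have t1 : P * (8 * (J : ℝ) ^ 2 / n) ≤ P * (ε / 2) := mul_le_mul_of_nonneg_left h8 (by linarith)
          have t2 : ε / 4 ≤ ε / 4 * P := le_mul_of_one_le_right (by positivity) hP1
          have : P * (1 + 8 * (J : ℝ) ^ 2 / n) + 4 * K * ((n : ℝ))⁻¹ ≤ (1 + ε) * P := by linarith [t1, t2, e2b]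
          have := mul_le_mul_of_nonneg_right this hΩc0.le
          linarith
  · -- lower bound
    rw [hsum, hcard, hlamD, le_div_iff₀ hD0]
    rw [le_div_iff₀ hΩc0] at hlo
    have hNr : (0 : ℝ) < (n : ℝ) + m' := by positivity
    -- `((n-J)/(n+m'))^{2J} ≥ 1 - 2J(J+m')/(n+m')`
    have hm0 : (0 : ℝ) ≤ m' := Nat.cast_nonneg m'
    have hb := one_add_mul_le_pow (a := -(((J : ℝ) + m') / ((n : ℝ) + m'))) (by
      rw [neg_le, neg_neg, div_le_iff₀ hNr]
      linarith) (2 * J)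
    have heq : 1 + -(((J : ℝ) + m') / ((n : ℝ) + m')) = ((n : ℝ) - J) / ((n : ℝ) + m') := by field_simp; ring
    rw [heq] at hb
    have hrpow : (n : ℝ) ^ (1 / 10 : ℝ) = (n : ℝ) ^ (-(9 / 10) : ℝ) * n := by
      rw [show (1 / 10 : ℝ) = -(9 / 10) + 1 by norm_num, Real.rpow_add hn0, Real.rpow_one]
    have hm'' : (m' : ℝ) ≤ (n : ℝ) ^ (-(9 / 10) : ℝ) * n := by rwa [hrpow] at hm'
    have hm'0 : (0 : ℝ) ≤ m' := Nat.cast_nonneg m'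
    have hr9 : (0 : ℝ) ≤ (n : ℝ) ^ (-(9 / 10) : ℝ) := Real.rpow_nonneg hn0.le _
    have hdev : 2 * J * (((J : ℝ) + m') / ((n : ℝ) + m')) ≤ ε / 2 := by
      have s1 : 2 * J * (((J : ℝ) + m') / ((n : ℝ) + m')) ≤ 2 * J * ((J : ℝ) + m') / n := by
        rw [mul_div_assoc]
        exact mul_le_mul_of_nonneg_left (div_le_div_of_nonneg_left (by positivity) hn0 (by linarith)) (by positivity)
      have s2 : 2 * J * ((J : ℝ) + m') / n ≤ 2 * (Jm : ℝ) ^ 2 * ((n : ℝ))⁻¹ + 2 * (Jm : ℝ) * (n : ℝ) ^ (-(9 / 10) : ℝ) := by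
        rw [div_eq_mul_inv]
        have hkey : (n : ℝ) ^ (-(9 / 10) : ℝ) * n * ((n : ℝ))⁻¹ = (n : ℝ) ^ (-(9 / 10) : ℝ) := by field_simp
        calc 2 * J * ((J : ℝ) + m') * ((n : ℝ))⁻¹ ≤ 2 * Jm * ((Jm : ℝ) + (n : ℝ) ^ (-(9 / 10) : ℝ) * n) * ((n : ℝ))⁻¹ := by
              refine mul_le_mul_of_nonneg_right ?_ hinv
              exact mul_le_mul (by linarith) (add_le_add hJr hm'') (by positivity) (by positivity)
          _ = 2 * (Jm : ℝ) ^ 2 * ((n : ℝ))⁻¹ + 2 * (Jm : ℝ) * ((n : ℝ) ^ (-(9 / 10) : ℝ) * n * ((n : ℝ))⁻¹) := by ring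
          _ = _ := by rw [hkey]
      linarith [e2c, e3]
    have hlow : 1 - ε ≤ (((n : ℝ) - J) / ((n : ℝ) + m')) ^ (2 * J) := by
      refine le_trans ?_ hb
      push_cast; linarith [hdev]
    calc (1 - ε) * Ωc * (P / D) * D = (1 - ε) * P * Ωc := by field_simp
      _ ≤ P * (((n : ℝ) - J) / ((n : ℝ) + m')) ^ (2 * J) * Ωc := by
          refine mul_le_mul_of_nonneg_right ?_ hΩc0.le
          rw [mul_comm (1 - ε) P]
          exact mul_le_mul_of_nonneg_left hlow (by linarith)
      _ ≤ _ := hlo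

end CycleMoments

end Literature.Computability.Complexity
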